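import Literature.AlgebraicGeometry.HodgeTheory.WeilClassesProductsOfFactors
import Literature.AlgebraicGeometry.HodgeTheory.AbelianVarietyEndomorphismsHOne
import Literature.AlgebraicGeometry.HodgeTheory.AbelianVarietyPullbackAlgebraicClasses
import Literature.AlgebraicGeometry.HodgeTheory.TopDegreeClasses
import Literature.AlgebraicGeometry.HodgeTheory.WeilClassesProducts
import Literature.AlgebraicGeometry.HodgeTheory.WeilClassesDescendingOfLefschetzOneOne
import Literature.AlgebraicGeometry.Motives.AimedSplitProductProofs
import Literature.AlgebraicGeometry.Motives.AbelianVarietyCohomologyExteriorH1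
import HarnessLib

/-!
# The Weil classes of a TWISTED SQUARE `(T × T, φ × (-φ))` are algebraic — for every abelian variety `T`

Family `hodge`, layer `Literature/AlgebraicGeometry/HodgeTheory`. Generalises the tree's
`WeilSurfaceCMSquareAlgebraic` (the CM square `E₀ × E₀` of a CURVE, `Φ = ψ₀ × (-ψ₀)`) from `g = 1` to
every dimension `g`, on the real carriers, with NO named fact and NO appeal to Lefschetz `(1,1)`.

Let `T` be a complex abelian variety of dimension `g ≥ 1` and `φ : T ⟶ T` with `φ ≫ φ = -(d • 𝟙 T)`,
`d ≥ 1` (`K = ℚ(√-d) ↪ End⁰(T)`, ANY multiplicities `(n′, n″)`, `n′ + n″ = g`). On `A = T × T` put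
`Φ = φ × (-φ) = prodLift (fst ≫ φ) (snd ≫ (-φ))` ("`ι × ῑ`": `K` acts through the conjugate embedding
on the second factor). Then `Φ ≫ Φ = -d`, `(A, Φ)` is of Weil type `(g, g)` — the `+i√d`-eigenspace of
`Φ^*` on `H¹(A) = p₁^*H¹(T) ⊕ p₂^*H¹(T)` is `p₁^*V₊ ⊕ p₂^*V₋` — and

* `weilClassesOf_twistedSquare_le_algebraicClasses` — **the Weil plane
  `weilClassesOf (T × T) Φ g d = W_K ⊗ ℂ ⊆ H^{2g}` consists of ALGEBRAIC classes**, unconditionally.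

PROOF (the tree's technique for `g = 1`, run in every `g`). Choose eigenbases `a₁,…,a_g` of
`V₊ = ker(φ^* - i√d)` and `b₁,…,b_g` of `V₋` in `H¹(T(ℂ); ℂ)` (`dim V± = g`:
`two_mul_finrank_eigenspace_eq`, `b₁ = 2g`). The Weil line `E₊(A) = ⋀^{2g}(p₁^*V₊ ⊕ p₂^*V₋)` is spanned
by `P = p₁^*α ⌣ p₂^*β`, `α = a₁ ⌣ ⋯ ⌣ a_g`, `β = b₁ ⌣ ⋯ ⌣ b_g` (`α, β ≠ 0` as wedge-basis vectors of
`H^g(T) = ⋀^g H¹`; `P ≠ 0` by Künneth). The top class `t = α ⌣ β ∈ H^{2g}(T)` is algebraic (a point),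
hence so is `m^*t` for the addition map `m = p₁ + p₂ : A ⟶ T`; since `m^* = p₁^* + p₂^*` on `H¹`
(`complexBetti_map_add_deg_one`) and `⌣` is multilinear,
`m^*t = ∏ᵢ(p₁^*aᵢ + p₂^*aᵢ) ⌣ ∏ⱼ(p₁^*bⱼ + p₂^*bⱼ) = Σ_{S,S'} τ_{S,S'}` over subsets `S, S' ⊆ {1..g}`,
each `τ_{S,S'}` a joint eigenclass of the test endomorphisms `(x·𝟙 + y·Φ)^*` with character
`(x + yμ)^r (x - yμ)^{2g-r}`, `μ = i√d`, `r = |S| + g - |S'|`, and `τ_{univ,∅} = P` the ONLY term with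
`r = 2g`. The operators `(x·𝟙 + Φ)^*` preserve algebraic classes (pull-back along an endomorphism,
`map_mem_algebraicClasses_of_abelianVariety`), so the Lagrange-type projector
`Q = ∏_{r<2g} ((x_r·𝟙 + Φ)^* - (x_r+μ)^r(x_r-μ)^{2g-r})`, with `x_r ∈ ℕ` chosen so that
`(x_r+μ)^r(x_r-μ)^{2g-r} ≠ (x_r+μ)^{2g}` (`exists_natCast_add_pow_mul_sub_pow_ne`), sends `m^*t` to a
NON-ZERO multiple of `P`: `P` is algebraic, and one non-zero algebraic class makes the Weil plane
algebraic (`weilClassesOf_le_algebraicClasses_of_exists_ne_zero`, complex conjugation for `E₋`).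

WHY IT MATTERS (B2b ladder `hodge-weil`, CENSUS ## P3-g4, note `TWISTED-SQUARES.md` §6): for `g`
odd the polarizations `aL ⊞ bL` of `(T × T, ι × ῑ)` have van Geemen discriminant `-ab · (square)`,
i.e. EVERY class of `ℚ_{<0}/Nm(K^×)`; so for every imaginary quadratic `K` and every `δ`, every
component `(K, g, δ)` of the moduli of polarized Weil-type abelian `2g`-folds — split or not —
contains the twisted squares of the `(n′, n″)`-type `K`-multiplication `g`-folds (an
`n′n″`-dimensional locus, e.g. the Picard-type threefolds for sixfolds) on which the Weil classes are
algebraic UNCONDITIONALLY. Equivalently (Hodge-group form): `W_K(T × T̄) ⊗ ℂ = ⋀^g St^* ⊗ ⋀^g St` is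
invariant under the full unitary group, hence a polynomial in divisor classes
(`W = ℚ⟨Re Ω^g, Im Ω^g⟩`, `Ω = (φ × 1)^*ω + √-d·ω`, `ω = m^*θ - p₁^*θ - p₂^*θ`) — the mechanism of
Deligne's CM anchors `Eⁿ × Ēⁿ` (LNM 900 §4–5), here for arbitrary `T`. Everything is proved; no
definition and no named fact is introduced.

## References

* [Schoen1998HodgeWeilAddendum] C. Schoen, Compositio Math. 114 (1998), §10 (products; `W ⊗ ℂ` bases).
* [vanGeemen1994HodgeAV] B. van Geemen, LNM 1594 (1994), 4.9, Lemma 5.2, 5.3–5.4, proof of Thm. 6.12.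
* [Deligne1982HodgeCycles] P. Deligne, LNM 900 (1982), §4 (4.4)–(4.5), Rem. 4.10.
* [LangeBirkenhake1992] H. Lange, Ch. Birkenhake, Complex Abelian Varieties (1992), 1.1.2, Lemma 1.1.17.
* [HatcherAT2002] A. Hatcher, Algebraic Topology (2002), §3.2 Prop. 3.10, Thm. 3.16.
* [Fulton1998] W. Fulton, Intersection Theory (1998), §19.1–19.2.
-/

noncomputable section

open CategoryTheory

namespace Literature.AlgebraicGeometry.HodgeTheory

open Literature.AlgebraicTopology.SingularHomology
open Literature.AlgebraicGeometry.Motives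

section HodgeTheory

variable {T B : Motives.AbelianVariety ℂ}

/-! ### Eigenvectors of `H¹` under pull-back (products of eigenvectors are joint eigenclasses: `cupPowOne_mem_pullbackEigenclasses`, file `WeilClassesDescendingOfLefschetzOneOne`) -/

/-- If `ψ ≫ p = p ≫ χ` (a homomorphism `p : B ⟶ T` intertwining `ψ` on `B` with `χ` on `T`) then `p^*`
carries `ν`-eigenvectors of `χ^*` on `H¹(T)` to `ν`-eigenvectors of `ψ^*` on `H¹(B)`
(`ψ^* p^* v = (ψ ≫ p)^* v = (p ≫ χ)^* v = p^* χ^* v`). [folklore] -/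
theorem map_mem_eigenspace_of_comp_eq {ψ : B ⟶ B} {p : B ⟶ T} {χ : T ⟶ T} (h : ψ ≫ p = p ≫ χ)
    {ν : ℂ} {v : complexBetti T.X 1}
    (hv : v ∈ Module.End.eigenspace (complexBetti.map χ.hom.hom.hom 1).hom ν) :
    complexBetti.map p.hom.hom.hom 1 v ∈ Module.End.eigenspace (complexBetti.map ψ.hom.hom.hom 1).hom ν := by
  rw [Module.End.mem_eigenspace_iff] at hv ⊢
  change complexBetti.map ψ.hom.hom.hom 1 (complexBetti.map p.hom.hom.hom 1 v) = _
  rw [complexBetti_map_map_hom, h, ← complexBetti_map_map_hom]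
  change complexBetti.map p.hom.hom.hom 1 ((complexBetti.map χ.hom.hom.hom 1).hom v) = _
  rw [hv, map_smul]

/-- A `ν`-eigenvector of `χ^*` on `H¹(T)` is a `(-ν)`-eigenvector of `(-χ)^*` (`(-χ)^* = -χ^*` on
`H¹`, `complexBetti_map_neg_deg_one`). [cite: LangeBirkenhake1992, 1.1.2] -/
theorem mem_eigenspace_neg_of_mem_eigenspace {χ : T ⟶ T} {ν : ℂ} {v : complexBetti T.X 1}
    (hv : v ∈ Module.End.eigenspace (complexBetti.map χ.hom.hom.hom 1).hom ν) :
    v ∈ Module.End.eigenspace (complexBetti.map (-χ).hom.hom.hom 1).hom (-ν) := by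
  rw [Module.End.mem_eigenspace_iff] at hv ⊢
  change complexBetti.map (-χ).hom.hom.hom 1 v = _
  rw [complexBetti_map_neg_deg_one]
  change -((complexBetti.map χ.hom.hom.hom 1).hom v) = _
  rw [hv, neg_smul]

/-! ### The twisted square `(T × T, Φ = φ × (-φ))` -/

variable {g d : ℕ} {φ : T ⟶ T}

/-- `Φ ≫ Φ = -d` for `Φ = φ × (-φ)` on `T × T` (`(-φ) ≫ (-φ) = φ ≫ φ`). [cite: Schoen1998HodgeWeilAddendum, §10] -/
theorem twistedSquare_comp_self (hφ : φ ≫ φ = -(d • 𝟙 T)) :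
    AbelianVariety.prodLift (AbelianVariety.fst T T ≫ φ) (AbelianVariety.snd T T ≫ (-φ)) ≫
        AbelianVariety.prodLift (AbelianVariety.fst T T ≫ φ) (AbelianVariety.snd T T ≫ (-φ)) =
      -(d • 𝟙 (T.prod T)) :=
  prodLift_comp_self_eq_neg_nsmul hφ (by rw [Preadditive.neg_comp_neg, hφ])

/-- `Φ ≫ p₁ = p₁ ≫ φ`. [folklore] -/
theorem twistedSquare_comp_fst :
    AbelianVariety.prodLift (AbelianVariety.fst T T ≫ φ) (AbelianVariety.snd T T ≫ (-φ)) ≫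
        AbelianVariety.fst T T = AbelianVariety.fst T T ≫ φ :=
  AbelianVariety.prodLift_fst _ _

/-- `Φ ≫ p₂ = p₂ ≫ (-φ)`. [folklore] -/
theorem twistedSquare_comp_snd :
    AbelianVariety.prodLift (AbelianVariety.fst T T ≫ φ) (AbelianVariety.snd T T ≫ (-φ)) ≫
        AbelianVariety.snd T T = AbelianVariety.snd T T ≫ (-φ) :=
  AbelianVariety.prodLift_snd _ _

/-- `dim (T × T) = 2g` for `dim T = g`. [folklore] -/
theorem dim_twistedSquare (hT : T.dim = g) : (T.prod T).dim = 2 * g := by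
  rw [AbelianVariety.dim_prod, hT, two_mul]


/-! ### A Lagrange-type projector onto one joint eigenclass (pure linear algebra) -/

section Projector

variable {V : Type*} [AddCommGroup V] [Module ℂ V]

/-- On a vector on which every operator `L r` acts by the scalar `χ r`, the product
`(L_{n-1} - ε_{n-1}) ⋯ (L_0 - ε_0)` acts by `∏_{r<n} (χ r - ε r)`. [folklore] -/
theorem listProd_sub_smul_apply_of_eigen (L : ℕ → V →ₗ[ℂ] V) (ε χ : ℕ → ℂ) (w : V)
    (hw : ∀ r, L r w = χ r • w) (n : ℕ) :
    ((List.range n).map fun r => L r - ε r • (LinearMap.id : V →ₗ[ℂ] V)).prod w =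
      (∏ r ∈ Finset.range n, (χ r - ε r)) • w := by
  induction n with
  | zero => simp
  | succ n ih =>
    rw [List.range_succ, List.map_append, List.prod_append, List.map_singleton, List.prod_singleton,
      Module.End.mul_apply, LinearMap.sub_apply, LinearMap.smul_apply, LinearMap.id_apply, hw n,
      ← sub_smul, map_smul, ih, smul_smul, Finset.prod_range_succ, mul_comm]

/-- If every `L r` preserves a submodule `N`, so does the product `(L_{n-1} - ε_{n-1}) ⋯ (L_0 - ε_0)`.
[folklore] -/
theorem listProd_sub_smul_apply_mem (L : ℕ → V →ₗ[ℂ] V) (ε : ℕ → ℂ) (N : Submodule ℂ V)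
    (hL : ∀ r, ∀ w ∈ N, L r w ∈ N) (n : ℕ) :
    ∀ {w : V}, w ∈ N → ((List.range n).map fun r => L r - ε r • (LinearMap.id : V →ₗ[ℂ] V)).prod w ∈ N := by
  induction n with
  | zero => intro w hw; simpa using hw
  | succ n ih =>
    intro w hw
    rw [List.range_succ, List.map_append, List.prod_append, List.map_singleton, List.prod_singleton,
      Module.End.mul_apply, LinearMap.sub_apply, LinearMap.smul_apply, LinearMap.id_apply]
    exact ih (N.sub_mem (hL n w hw) (N.smul_mem _ hw))

end Projector

/-! ### The main theorem -/

section Main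

variable {T : Motives.AbelianVariety ℂ} {g d : ℕ} {φ : T ⟶ T}

/-- **A non-zero ALGEBRAIC class on the Weil line `E₊` of the twisted square** `(T × T, φ × (-φ))`,
for every complex abelian variety `T` of dimension `g ≥ 1` and `φ ≫ φ = -(d • 𝟙 T)`, `d ≥ 1`:
`P = p₁^*(a₁ ⌣ ⋯ ⌣ a_g) ⌣ p₂^*(b₁ ⌣ ⋯ ⌣ b_g)` for eigenbases `aᵢ ∈ V₊`, `bⱼ ∈ V₋` of `φ^*` on `H¹(T)`
— non-zero by Künneth, in `E₊` as a product of `+i√d`-eigenvectors of `Φ^*`, and algebraic as the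
image of the algebraic class `(p₁ + p₂)^*(α ⌣ β)` under a polynomial in the pull-backs `(x·𝟙 + Φ)^*`
(module docstring). [cite: Schoen1998HodgeWeilAddendum, §10] [cite: vanGeemen1994HodgeAV, proof of Lemma 5.2 and of Thm. 6.12]
[cite: HatcherAT2002, §3.2 Prop. 3.10 and Thm. 3.16] -/
theorem exists_mem_weilClassesPlus_twistedSquare_algebraic_ne_zero (hg : 0 < g) (hT : T.dim = g)
    (hd : 0 < d) (hφ : φ ≫ φ = -(d • 𝟙 T)) :
    ∃ P ∈ weilClassesPlus (T.prod T)
        (AbelianVariety.prodLift (AbelianVariety.fst T T ≫ φ) (AbelianVariety.snd T T ≫ (-φ))) g d,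
      P ∈ algebraicClasses (T.prod T).X g ∧ P ≠ 0 := by
  classical
  -- notation
  set A := T.prod T with hA
  set Φ : A ⟶ A := AbelianVariety.prodLift (AbelianVariety.fst T T ≫ φ) (AbelianVariety.snd T T ≫ (-φ))
    with hΦdef
  set p₁ : A ⟶ T := AbelianVariety.fst T T with hp₁
  set p₂ : A ⟶ T := AbelianVariety.snd T T with hp₂
  set μ : ℂ := Complex.I * (Real.sqrt d : ℂ) with hμ
  have hμ0 : μ ≠ 0 := I_mul_sqrt_ne_zero hd
  set Tφ := (complexBetti.map φ.hom.hom.hom 1).hom with hTφ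
  -- `H¹(T) = V₊ ⊕ V₋`, both of dimension `g`
  haveI := finite_complexBetti_abelianVariety T 1
  have hb₁T : Module.finrank ℂ (complexBetti T.X 1) = 2 * g := by
    rw [AbelianVariety.finrank_complexBetti_one, hT]
  have hp : Module.finrank ℂ (Module.End.eigenspace Tφ μ) = g := by
    have h := two_mul_finrank_eigenspace_eq hd hφ
    rw [hb₁T] at h
    change 2 * Module.finrank ℂ (Module.End.eigenspace Tφ μ) = 2 * g at h
    omega
  have hq : Module.finrank ℂ (Module.End.eigenspace Tφ (-μ)) = g := by
    have h := finrank_eigenspace_eq_finrank_eigenspace_neg hd hφ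
    change Module.finrank ℂ (Module.End.eigenspace Tφ μ) =
      Module.finrank ℂ (Module.End.eigenspace Tφ (-μ)) at h
    rw [← h, hp]
  let bp := Module.finBasisOfFinrankEq ℂ (Module.End.eigenspace Tφ μ) hp
  let bm := Module.finBasisOfFinrankEq ℂ (Module.End.eigenspace Tφ (-μ)) hq
  let a : Fin g → complexBetti T.X 1 := fun i => (bp i : complexBetti T.X 1)
  let b : Fin g → complexBetti T.X 1 := fun j => (bm j : complexBetti T.X 1)
  have ha : ∀ i, a i ∈ Module.End.eigenspace Tφ μ := fun i => (bp i).2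
  have hb : ∀ j, b j ∈ Module.End.eigenspace Tφ (-μ) := fun j => (bm j).2
  -- the combined eigenbasis of `H¹(T)` and the wedge basis of `H^g(T)`: `α, β ≠ 0`
  have hcompl : IsCompl (Module.End.eigenspace Tφ μ) (Module.End.eigenspace Tφ (-μ)) :=
    isCompl_eigenspace_eigenspace_neg hd hφ
  let bb₀ : Module.Basis (Fin g ⊕ Fin g) ℂ (complexBetti T.X 1) :=
    (bp.prod bm).map (Submodule.prodEquivOfIsCompl _ _ hcompl)
  let bb : Module.Basis (Fin (g + g)) ℂ (complexBetti T.X 1) := bb₀.reindex finSumFinEquiv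
  have hbb_left : ∀ i : Fin g, bb (Fin.castAdd g i) = a i := by
    intro i
    rw [Module.Basis.reindex_apply, finSumFinEquiv_symm_apply_castAdd]
    simp only [Sum.elim_inl, bb₀, Module.Basis.map_apply, Module.Basis.prod_apply, Function.comp_apply,
      LinearMap.inl_apply, Submodule.coe_prodEquivOfIsCompl', Submodule.coe_zero, add_zero]
    rfl
  have hbb_right : ∀ j : Fin g, bb (Fin.natAdd g j) = b j := by
    intro j
    rw [Module.Basis.reindex_apply, finSumFinEquiv_symm_apply_natAdd]
    simp only [Sum.elim_inr, bb₀, Module.Basis.map_apply, Module.Basis.prod_apply, Function.comp_apply,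
      LinearMap.inr_apply, Submodule.coe_prodEquivOfIsCompl', Submodule.coe_zero, zero_add]
    rfl
  have hΛT := AbelianVariety.hasExteriorCohomologyH1_complexPoints T
  let BwT : Module.Basis (Set.powersetCard (Fin (g + g)) g) ℂ (complexBetti T.X g) :=
    (bb.exteriorPower g).map (hΛT.equiv g)
  have hBwT : ∀ S, BwT S = cupPowOne ℂ (Motives.ComplexPoints T.X) g
      (bb ∘ (Set.powersetCard.ofFinEmbEquiv.symm S)) := by
    intro S
    change hΛT.equiv g ((bb.exteriorPower g) S) = _
    rw [exteriorPower.basis_apply, HasExteriorCohomologyH1.equiv_apply, exteriorPower.ιMulti_family,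
      wedgeToCup_ιMulti]
  set α : complexBetti T.X g := cupPowOne ℂ (Motives.ComplexPoints T.X) g a with hαdef
  set β : complexBetti T.X g := cupPowOne ℂ (Motives.ComplexPoints T.X) g b with hβdef
  have hαBw : α = BwT (Set.powersetCard.ofFinEmbEquiv (Fin.castAddOrderEmb g)) := by
    rw [hBwT, Equiv.symm_apply_apply, hαdef]
    congr 1
    funext i
    exact (hbb_left i).symm
  have hβBw : β = BwT (Set.powersetCard.ofFinEmbEquiv (Fin.natAddOrderEmb g)) := by
    rw [hBwT, Equiv.symm_apply_apply, hβdef]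
    congr 1
    funext j
    exact (hbb_right j).symm
  have hα0 : α ≠ 0 := by rw [hαBw]; exact BwT.ne_zero _
  have hβ0 : β ≠ 0 := by rw [hβBw]; exact BwT.ne_zero _
  -- smoothness / dimensions
  have hX : IsSmoothProjective g T.X := Motives.isSmoothProjective_of_dim_eq' hT
  have hdimA : A.dim = 2 * g := dim_twistedSquare hT
  have hXA : IsSmoothProjective (2 * g) A.X := Motives.isSmoothProjective_of_dim_eq' hdimA
  have hΛA := AbelianVariety.hasExteriorCohomologyH1_complexPoints A
  have hb₁A : Module.finrank ℂ (complexBetti A.X 1) = 2 * (2 * g) := by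
    rw [AbelianVariety.finrank_complexBetti_one, hdimA]
  have hΦ : Φ ≫ Φ = -(d • 𝟙 A) := twistedSquare_comp_self hφ
  have hΦ1 : Φ ≫ p₁ = p₁ ≫ φ := AbelianVariety.prodLift_fst _ _
  have hΦ2 : Φ ≫ p₂ = p₂ ≫ (-φ) := AbelianVariety.prodLift_snd _ _
  have hgg : g + g = 2 * g := (two_mul g).symm
  -- the four families of eigenvectors on `A`
  set TΦ := (complexBetti.map Φ.hom.hom.hom 1).hom with hTΦ
  let aP : Fin g → complexBetti A.X 1 := fun i => complexBetti.map p₁.hom.hom.hom 1 (a i)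
  let aM : Fin g → complexBetti A.X 1 := fun i => complexBetti.map p₂.hom.hom.hom 1 (a i)
  let bM : Fin g → complexBetti A.X 1 := fun j => complexBetti.map p₁.hom.hom.hom 1 (b j)
  let bP : Fin g → complexBetti A.X 1 := fun j => complexBetti.map p₂.hom.hom.hom 1 (b j)
  have haP : ∀ i, aP i ∈ Module.End.eigenspace TΦ μ := fun i => map_mem_eigenspace_of_comp_eq hΦ1 (ha i)
  have haM : ∀ i, aM i ∈ Module.End.eigenspace TΦ (-μ) := fun i =>
    map_mem_eigenspace_of_comp_eq hΦ2 (mem_eigenspace_neg_of_mem_eigenspace (ha i))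
  have hbM : ∀ j, bM j ∈ Module.End.eigenspace TΦ (-μ) := fun j => map_mem_eigenspace_of_comp_eq hΦ1 (hb j)
  have hbP : ∀ j, bP j ∈ Module.End.eigenspace TΦ μ := fun j => by
    have h := map_mem_eigenspace_of_comp_eq hΦ2 (mem_eigenspace_neg_of_mem_eigenspace (hb j))
    rwa [neg_neg] at h
  -- the class `P = p₁^*α ⌣ p₂^*β`: non-zero (Künneth) and in `E₊`
  set P : complexBetti A.X (2 * g) :=
    cupProduct hgg (cupPowOne ℂ (Motives.ComplexPoints A.X) g aP) (cupPowOne ℂ (Motives.ComplexPoints A.X) g bP)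
    with hPdef
  have hPeq : P = cupProduct hgg (complexBetti.map p₁.hom.hom.hom g α) (complexBetti.map p₂.hom.hom.hom g β) := by
    rw [hPdef, hαdef, hβdef, complexBetti_map_cupPowOne, complexBetti_map_cupPowOne]
  have hP0 : P ≠ 0 := by
    rw [hPeq]
    exact cupProduct_map_fst_map_snd_ne_zero_of_add_eq hX hX hgg (by omega) hα0 hβ0
  have hPplus : P ∈ weilClassesPlus A Φ g d := by
    have h1 := cupPowOne_mem_pullbackEigenclasses (lam := fun _ => μ) haP
    have h2 := cupPowOne_mem_pullbackEigenclasses (lam := fun _ => μ) hbP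
    have h12 := cupProduct_mem_pullbackEigenclasses hgg h1 h2
    have e : (fun x y : ℕ => (∏ _i : Fin g, ((x : ℂ) + (y : ℂ) * μ)) * ∏ _i : Fin g, ((x : ℂ) + (y : ℂ) * μ)) =
        fun x y : ℕ => ((x : ℂ) + (y : ℂ) * Complex.I * (Real.sqrt d : ℂ)) ^ (2 * g) := by
      funext x y
      rw [Finset.prod_const, Finset.card_univ, Fintype.card_fin, ← pow_add, hgg, hμ, mul_assoc]
    rw [weilClassesPlus, ← e]
    exact h12
  -- the algebraic class `m^* t`, `t = α ⌣ β` of top degree on `T`, `m = p₁ + p₂` the addition map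
  set t : complexBetti T.X (2 * g) := cupProduct hgg α β with htdef
  have ht_alg : t ∈ algebraicClasses T.X g := mem_algebraicClasses_of_degree_top hX hg t
  set m : A ⟶ T := p₁ + p₂ with hmdef
  have hmt_alg : complexBetti.map m.hom.hom.hom (2 * g) t ∈ algebraicClasses A.X g :=
    map_mem_algebraicClasses_of_abelianVariety hXA T m.hom.hom.hom ht_alg
  -- `m^* t = ∏ᵢ (p₁^*aᵢ + p₂^*aᵢ) ⌣ ∏ⱼ (p₁^*bⱼ + p₂^*bⱼ)`
  have hmt : complexBetti.map m.hom.hom.hom (2 * g) t =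
      cupProduct hgg (cupPowOne ℂ (Motives.ComplexPoints A.X) g (aP + aM))
        (cupPowOne ℂ (Motives.ComplexPoints A.X) g (bM + bP)) := by
    rw [htdef]
    change singularCohomology.map ℂ ℂ (Motives.AlgPoints.mapContinuous (L := ℂ) m.hom.hom.hom) (2 * g)
      (cupProduct hgg α β) = _
    rw [cupProduct_map]
    change cupProduct hgg (complexBetti.map m.hom.hom.hom g α) (complexBetti.map m.hom.hom.hom g β) = _
    rw [hαdef, hβdef, complexBetti_map_cupPowOne, complexBetti_map_cupPowOne]
    have e1 : (fun i => complexBetti.map m.hom.hom.hom 1 (a i)) = aP + aM := by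
      funext i; rw [hmdef, complexBetti_map_add_deg_one]; rfl
    have e2 : (fun j => complexBetti.map m.hom.hom.hom 1 (b j)) = bM + bP := by
      funext j; rw [hmdef, complexBetti_map_add_deg_one]; rfl
    rw [e1, e2]
  -- multilinear expansion over subsets: `m^* t = Σ_{S, S'} τ S S'`
  let τ : Finset (Fin g) → Finset (Fin g) → complexBetti A.X (2 * g) := fun S S' =>
    cupProduct hgg (cupPowOne ℂ (Motives.ComplexPoints A.X) g (S.piecewise aP aM))
      (cupPowOne ℂ (Motives.ComplexPoints A.X) g (S'.piecewise bM bP))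
  have hmt_sum : complexBetti.map m.hom.hom.hom (2 * g) t = ∑ S, ∑ S', τ S S' := by
    rw [hmt, MultilinearMap.map_add_univ _ aP aM, MultilinearMap.map_add_univ _ bM bP, map_sum]
    have hS' : ∀ S' : Finset (Fin g),
        cupProduct hgg (∑ S : Finset (Fin g), cupPowOne ℂ (Motives.ComplexPoints A.X) g (S.piecewise aP aM))
          (cupPowOne ℂ (Motives.ComplexPoints A.X) g (S'.piecewise bM bP)) = ∑ S, τ S S' := by
      intro S'
      rw [map_sum, LinearMap.sum_apply]
    rw [Finset.sum_congr rfl (fun S' _ => hS' S'), Finset.sum_comm]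
  have hτP : τ Finset.univ ∅ = P := by
    change cupProduct hgg (cupPowOne ℂ _ g (Finset.univ.piecewise aP aM))
      (cupPowOne ℂ _ g ((∅ : Finset (Fin g)).piecewise bM bP)) = P
    rw [Finset.piecewise_univ, Finset.piecewise_empty]
  -- the characters of the terms
  have hprod_ite : ∀ (S : Finset (Fin g)) (u v : ℂ),
      ∏ i : Fin g, (if i ∈ S then u else v) = u ^ S.card * v ^ (g - S.card) := by
    intro S u v
    rw [Finset.prod_ite, Finset.prod_const, Finset.prod_const, Finset.filter_mem_eq_inter,
      Finset.univ_inter, Finset.filter_not, Finset.filter_mem_eq_inter, Finset.univ_inter,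
      Finset.card_univ_sdiff, Fintype.card_fin]
  have hτ_eig : ∀ S S', τ S S' ∈ pullbackEigenclasses A Φ (2 * g)
      (fun x y => ((x : ℂ) + (y : ℂ) * μ) ^ (S.card + (g - S'.card)) *
        ((x : ℂ) - (y : ℂ) * μ) ^ (2 * g - (S.card + (g - S'.card)))) := by
    intro S S'
    have hS : S.card ≤ g := by simpa using Finset.card_le_univ S
    have hS' : S'.card ≤ g := by simpa using Finset.card_le_univ S'
    have hw1 : ∀ i, S.piecewise aP aM i ∈ Module.End.eigenspace TΦ (if i ∈ S then μ else -μ) := by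
      intro i
      by_cases hi : i ∈ S
      · rw [Finset.piecewise_eq_of_mem _ _ _ hi, if_pos hi]; exact haP i
      · rw [Finset.piecewise_eq_of_notMem _ _ _ hi, if_neg hi]; exact haM i
    have hw2 : ∀ j, S'.piecewise bM bP j ∈ Module.End.eigenspace TΦ (if j ∈ S' then -μ else μ) := by
      intro j
      by_cases hj : j ∈ S'
      · rw [Finset.piecewise_eq_of_mem _ _ _ hj, if_pos hj]; exact hbM j
      · rw [Finset.piecewise_eq_of_notMem _ _ _ hj, if_neg hj]; exact hbP j
    have h1 := cupPowOne_mem_pullbackEigenclasses (lam := fun i => if i ∈ S then μ else -μ) hw1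
    have h2 := cupPowOne_mem_pullbackEigenclasses (lam := fun j => if j ∈ S' then -μ else μ) hw2
    have h12 := cupProduct_mem_pullbackEigenclasses hgg h1 h2
    have e : (fun x y : ℕ => (∏ i : Fin g, ((x : ℂ) + (y : ℂ) * (if i ∈ S then μ else -μ))) *
        ∏ j : Fin g, ((x : ℂ) + (y : ℂ) * (if j ∈ S' then -μ else μ))) =
        fun x y : ℕ => ((x : ℂ) + (y : ℂ) * μ) ^ (S.card + (g - S'.card)) *
          ((x : ℂ) - (y : ℂ) * μ) ^ (2 * g - (S.card + (g - S'.card))) := by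
      funext x y
      have i1 : (fun i : Fin g => (x : ℂ) + (y : ℂ) * (if i ∈ S then μ else -μ)) =
          fun i => if i ∈ S then (x : ℂ) + (y : ℂ) * μ else (x : ℂ) - (y : ℂ) * μ := by
        funext i; split_ifs <;> ring
      have i2 : (fun j : Fin g => (x : ℂ) + (y : ℂ) * (if j ∈ S' then -μ else μ)) =
          fun j => if j ∈ S' then (x : ℂ) - (y : ℂ) * μ else (x : ℂ) + (y : ℂ) * μ := by
        funext j; split_ifs <;> ring
      rw [i1, i2, hprod_ite, hprod_ite,
        show 2 * g - (S.card + (g - S'.card)) = (g - S.card) + S'.card by omega]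
      ring
    rw [← e]
    exact h12
  -- the test points `x_r` and the projector `Q = ∏_{r < 2g} ((x_r·𝟙 + Φ)^* - ε_r)`
  have hxs : ∀ r : ℕ, r < 2 * g →
      ∃ x : ℕ, ((x : ℂ) + μ) ^ r * ((x : ℂ) - μ) ^ (2 * g - r) ≠ ((x : ℂ) + μ) ^ (2 * g) := by
    intro r hr
    obtain ⟨x, hx⟩ := exists_natCast_add_pow_mul_sub_pow_ne hμ0 r (Nat.sub_pos_of_lt hr)
    refine ⟨x, ?_⟩
    rwa [Nat.add_sub_cancel' hr.le] at hx
  let xs : ℕ → ℕ := fun r => if h : r < 2 * g then Classical.choose (hxs r h) else 0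
  have hxs' : ∀ r, r < 2 * g →
      ((xs r : ℂ) + μ) ^ r * ((xs r : ℂ) - μ) ^ (2 * g - r) ≠ ((xs r : ℂ) + μ) ^ (2 * g) := by
    intro r hr
    have h := Classical.choose_spec (hxs r hr)
    simp only [xs, dif_pos hr]
    exact h
  let ε : ℕ → ℂ := fun r => ((xs r : ℂ) + μ) ^ r * ((xs r : ℂ) - μ) ^ (2 * g - r)
  let L : ℕ → (complexBetti A.X (2 * g) →ₗ[ℂ] complexBetti A.X (2 * g)) := fun r =>
    (complexBetti.map ((xs r) • 𝟙 A + (1 : ℕ) • Φ).hom.hom.hom (2 * g)).hom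
  let Q : complexBetti A.X (2 * g) →ₗ[ℂ] complexBetti A.X (2 * g) :=
    ((List.range (2 * g)).map fun r => L r - ε r • (LinearMap.id : _ →ₗ[ℂ] _)).prod
  have hL_eig : ∀ {χ : ℕ → ℕ → ℂ} {c : complexBetti A.X (2 * g)},
      c ∈ pullbackEigenclasses A Φ (2 * g) χ → ∀ r, L r c = χ (xs r) 1 • c := by
    intro χ c hc r
    exact (mem_pullbackEigenclasses_iff.mp hc) (xs r) 1
  have hQ_alg : ∀ {w : complexBetti A.X (2 * g)}, w ∈ algebraicClasses A.X g → Q w ∈ algebraicClasses A.X g :=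
    fun hw => listProd_sub_smul_apply_mem L ε (algebraicClasses A.X g)
      (fun r w hw => map_mem_algebraicClasses_of_abelianVariety hXA A ((xs r) • 𝟙 A + (1 : ℕ) • Φ).hom.hom.hom hw)
      (2 * g) hw
  have hQτ : ∀ S S', Q (τ S S') = (∏ r ∈ Finset.range (2 * g),
      ((((xs r : ℂ) + μ) ^ (S.card + (g - S'.card)) *
        ((xs r : ℂ) - μ) ^ (2 * g - (S.card + (g - S'.card)))) - ε r)) • τ S S' := by
    intro S S'
    refine listProd_sub_smul_apply_of_eigen L ε _ (τ S S') (fun r => ?_) (2 * g)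
    have h := hL_eig (hτ_eig S S') r
    simpa only [Nat.cast_one, one_mul] using h
  have hQτ0 : ∀ S S', ¬ (S = Finset.univ ∧ S' = ∅) → Q (τ S S') = 0 := by
    intro S S' hne
    rw [hQτ]
    have hS : S.card ≤ g := by simpa using Finset.card_le_univ S
    have hS' : S'.card ≤ g := by simpa using Finset.card_le_univ S'
    have hr : S.card + (g - S'.card) < 2 * g := by
      by_contra hge
      have h1 : S.card = g := by omega
      have h2 : S'.card = 0 := by omega
      refine hne ⟨Finset.eq_univ_of_card S (by simpa using h1), Finset.card_eq_zero.mp h2⟩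
    rw [Finset.prod_eq_zero (Finset.mem_range.mpr hr) (by simp only [ε, sub_self]), zero_smul]
  have hQP : Q P = (∏ r ∈ Finset.range (2 * g), (((xs r : ℂ) + μ) ^ (2 * g) - ε r)) • P := by
    rw [← hτP, hQτ]
    congr 1
    refine Finset.prod_congr rfl fun r _ => ?_
    rw [Finset.card_univ, Fintype.card_fin, Finset.card_empty, Nat.sub_zero, hgg, Nat.sub_self, pow_zero,
      mul_one]
  have hκ : (∏ r ∈ Finset.range (2 * g), (((xs r : ℂ) + μ) ^ (2 * g) - ε r)) ≠ 0 := by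
    rw [Finset.prod_ne_zero_iff]
    intro r hr
    exact sub_ne_zero.mpr (hxs' r (Finset.mem_range.mp hr)).symm
  have hQmt : Q (complexBetti.map m.hom.hom.hom (2 * g) t) =
      (∏ r ∈ Finset.range (2 * g), (((xs r : ℂ) + μ) ^ (2 * g) - ε r)) • P := by
    rw [hmt_sum, map_sum, Finset.sum_eq_single (Finset.univ : Finset (Fin g)), map_sum,
      Finset.sum_eq_single (∅ : Finset (Fin g)), hτP, hQP]
    · intro S' _ hS'
      exact hQτ0 _ _ fun h => hS' h.2
    · intro h; exact absurd (Finset.mem_univ _) h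
    · intro S _ hS
      rw [map_sum]
      exact Finset.sum_eq_zero fun S' _ => hQτ0 _ _ fun h => hS h.1
    · intro h; exact absurd (Finset.mem_univ _) h
  -- conclusion
  refine ⟨P, hPplus, ?_, hP0⟩
  have h := hQ_alg hmt_alg
  rw [hQmt] at h
  simpa only [inv_smul_smul₀ hκ] using (algebraicClasses A.X g).smul_mem
    (∏ r ∈ Finset.range (2 * g), (((xs r : ℂ) + μ) ^ (2 * g) - ε r))⁻¹ h


/-- **The Weil classes of the twisted square `(T × T, φ × (-φ))` are algebraic — for EVERY complex
abelian variety `T`** of dimension `g ≥ 1` with `φ ≫ φ = -(d • 𝟙 T)`, `d ≥ 1`: the Weil plane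
`weilClassesOf (T × T) (φ × (-φ)) g d = E₊ ⊔ E₋ ⊆ H^{2g}((T × T)(ℂ); ℂ)` lies in
`algebraicClasses (T × T).X g`. One non-zero algebraic class on `E₊`
(`exists_mem_weilClassesPlus_twistedSquare_algebraic_ne_zero`) suffices: `E±` are lines and complex
conjugation exchanges them (`weilClassesOf_le_algebraicClasses_of_exists_ne_zero`). No named fact, no
Lefschetz `(1,1)`, no hypothesis on `T` beyond `φ² = -d`. [cite: Schoen1998HodgeWeilAddendum, §10]
[cite: vanGeemen1994HodgeAV, 4.9 and proof of Thm. 6.12] [cite: Deligne1982HodgeCycles, §4 (4.4)–(4.5)] -/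
theorem weilClassesOf_twistedSquare_le_algebraicClasses (hg : 0 < g) (hT : T.dim = g) (hd : 0 < d)
    (hφ : φ ≫ φ = -(d • 𝟙 T)) :
    weilClassesOf (T.prod T)
        (AbelianVariety.prodLift (AbelianVariety.fst T T ≫ φ) (AbelianVariety.snd T T ≫ (-φ))) g d ≤
      algebraicClasses (T.prod T).X g := by
  obtain ⟨P, hP, hPa, hP0⟩ := exists_mem_weilClassesPlus_twistedSquare_algebraic_ne_zero hg hT hd hφ
  have hb₁ : Module.finrank ℂ (complexBetti (T.prod T).X 1) = 2 * (2 * g) := by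
    rw [AbelianVariety.finrank_complexBetti_one, dim_twistedSquare hT]
  exact weilClassesOf_le_algebraicClasses_of_exists_ne_zero hg hd (twistedSquare_comp_self hφ)
    (AbelianVariety.hasExteriorCohomologyH1_complexPoints (T.prod T)) hb₁
    ⟨P, weilClassesPlus_le_weilClassesOf _ _ g d hP, hPa, hP0⟩

/-- **Pointwise shape** (the shape of the tree's Weil-class facts and of the ladder's rungs): every class —
in particular every rational class of Hodge type `(g, g)` — of the Weil plane of the twisted square
`(T × T, φ × (-φ))` is algebraic, for every complex abelian variety `T` of dimension `g ≥ 1` and every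
`φ ≫ φ = -(d • 𝟙 T)`, `d ≥ 1`. [cite: vanGeemen1994HodgeAV, 4.9] -/
theorem mem_algebraicClasses_of_mem_weilClassesOf_twistedSquare (hg : 0 < g) (hT : T.dim = g)
    (hd : 0 < d) (hφ : φ ≫ φ = -(d • 𝟙 T)) :
    ∀ c : complexBetti (T.prod T).X (2 * g), IsRationalClass c →
      IsOfHodgeType (2 * g) (T.prod T).X (2 * g) g g c →
        c ∈ weilClassesOf (T.prod T)
          (AbelianVariety.prodLift (AbelianVariety.fst T T ≫ φ) (AbelianVariety.snd T T ≫ (-φ))) g d →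
          c ∈ algebraicClasses (T.prod T).X g :=
  fun _ _ _ hcW ↦ weilClassesOf_twistedSquare_le_algebraicClasses hg hT hd hφ hcW

/-- **Sixfolds (`g = 3`)**: for every complex abelian THREEFOLD `T` with `φ ≫ φ = -(d • 𝟙 T)`, `d ≥ 1`
(`K = ℚ(√-d) ⊂ End⁰(T)`; e.g. the Picard-type threefolds, multiplicities `(2,1)`), the Weil classes
of the sixfold `(T × T, φ × (-φ))` are algebraic. For `g` odd the product polarizations `aL ⊞ bL` give
van Geemen discriminant `-ab·(square)`, i.e. every class: these sixfolds meet EVERY component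
`(K, 3, δ)` — split or not — of the moduli of polarized Weil-type sixfolds (packet note
`TWISTED-SQUARES.md`; discriminants are not on the carriers). [cite: vanGeemen1994HodgeAV, Lemma 5.2 and 5.3–5.4]
[cite: Markman2025SurveySecant, §11.5 Step 1] -/
theorem weilClassesOf_twistedSquare_threefold_le_algebraicClasses (hT : T.dim = 3) (hd : 0 < d)
    (hφ : φ ≫ φ = -(d • 𝟙 T)) :
    weilClassesOf (T.prod T)
        (AbelianVariety.prodLift (AbelianVariety.fst T T ≫ φ) (AbelianVariety.snd T T ≫ (-φ))) 3 d ≤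
      algebraicClasses (T.prod T).X 3 :=
  weilClassesOf_twistedSquare_le_algebraicClasses (by norm_num) hT hd hφ

end Main

end HodgeTheory

end Literature.AlgebraicGeometry.HodgeTheory

end
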